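import Literature.NumberTheory.EllipticCurves.Castella2024.LambdaAdicHeegnerClassExistence
import Literature.NumberTheory.EllipticCurves.IwasawaAlgebra
import HarnessLib

/-!
# Route UniversalToricDescent — the KUMMER BRIDGE of line `beta-road` (crux `TwinAlgMuZeroAtThree`, 24737) PROVED:
# a locally indivisible layer point forces `loc 𝐳_∞ ∉ (p)` for every «layer-compatible» functional `loc`

Lead prover bsd-wall-utd-p1 g22 (`--supports stmt-BirchSwinnertonDyer-24737`, registered line `beta-road` v3 9546c2810ecca8f3).
Clause (ii) of the print-port stub `stub_packageMult` («if some layer point `z_k` of the Heegner family is locally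
`p`-indivisible at `𝔭` then `loc 𝐳_∞ ∉ (p)`») is KERNEL GLUE once the localisation functional `loc : 𝔖 → Λ` has the
LAYER-COMPATIBILITY property (L): «`loc s ∈ (p)` ⟹ for every layer `k` the mod-`p` component of `s` restricted to the
decomposition group `Γ_{K_k} ∩ D` vanishes» — which is what `loc = (H¹_Gr(K_𝔭, 𝐓) ≅ Λ) ∘ loc_𝔭` satisfies when
`H¹_Gr(K_𝔭, 𝐓)` is FREE of rank one (a class in `p·U_𝔭` has layer components `p·(…)`, whose reduction mod `p` is `0`).
This file proves, for ANY prime `p`, curve `E/ℚ`, number field `K`, `ℤ_p`-extension `κ`, `Λ`-adic Selmer datum `D`,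
Heegner family `F`, sign `α` with `α² = 1`, `Λ`-adic Heegner class `z` (`Castella2024.IsLambdaAdicHeegnerClass D F α z`:
`proj_k z = α^{k+1}·δ_{K_k}(z_k)`), subgroup `D ≤ Γ_K` and `Λ`-linear `loc` with (L):

* §1 `zsmul_eq_zero_of_sq_eq_one` — `α² = 1`, `α^{k+1} • x = 0` ⟹ `x = 0` in any additive group.
* §2 **`loc_not_mem_augIdealP_of_layerIndivisible`** — (L) ∧ (∃ k, every `p`-th root `Q` of `z_k` has non-zero
  Kummer class on `Γ_{K_k} ∩ D`) ⟹ `loc z ∉ (p)`. Proof: `res ∘ proj_k (z)` at precision `1` is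
  `α^{k+1} • δ_{Γ_{K_k} ∩ D}(Q)` (`IsLambdaAdicHeegnerClass.proj_eq` + `resOfLe_kummerClassOver`), so (L) and §1 give
  `δ_{Γ_{K_k} ∩ D}(Q) = 0`, contradicting the indivisibility.

So the research/port surface of `stub_packageMult` is exactly: the Λ-adic Poitou–Tate inequality (i) and property (L)
of ONE functional. THEOREMS ONLY; no `Theses` import; std axioms. BSD is not advanced by this file; 24737 stays open.
References: [Castella2017HeegnerBeilinsonFlach] App. A; [BertoliniDarmon1996] §2.5; [SilvermanAEC2009] VIII.§2.
-/

noncomputable section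
open scoped Classical

-- `…BirchSwinnertonDyer.BirchSwinnertonDyer.Theorems…` is the problem's mandated namespace (D-0017).
set_option linter.dupNamespace false
set_option autoImplicit false

namespace Summit.BirchSwinnertonDyer.BirchSwinnertonDyer.Theorems.UniversalToricDescentHeegnerClassKummerBridge

open NumberField Field WeierstrassCurve
open Literature.NumberTheory.EllipticCurves Literature.NumberTheory.EllipticCurves.IwasawaAlgebra
  Literature.NumberTheory.EllipticCurves.Castella2024

universe u

/-! ### §1 Signs are harmless -/

/-- `α² = 1` and `α^{k+1} • x = 0` ⟹ `x = 0` (multiply once more by `α^{k+1}`: `(α^{k+1})² = (α²)^{k+1} = 1`). [folklore] -/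
theorem zsmul_eq_zero_of_sq_eq_one {A : Type*} [AddCommGroup A] {α : ℤ} (hα : α ^ 2 = 1) (k : ℕ) {x : A}
    (hx : (α ^ (k + 1)) • x = 0) : x = 0 := by
  have h1 : α ^ (k + 1) * α ^ (k + 1) = 1 := by
    rw [← pow_two, ← pow_mul, mul_comm, pow_mul, hα, one_pow]
  calc x = (α ^ (k + 1) * α ^ (k + 1)) • x := by rw [h1, one_zsmul]
    _ = (α ^ (k + 1)) • ((α ^ (k + 1)) • x) := mul_zsmul _ _ _
    _ = 0 := by rw [hx, zsmul_zero]

/-! ### §2 The bridge -/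

variable {K : Type u} [Field K] [NumberField K] {N : ℕ} [NeZero N] {W : WeierstrassCurve ℚ}
  {p : ℕ} [Fact p.Prime] {κ : ZpExtension K p} {γ : Field.absoluteGaloisGroup K}
  {jbar : AlgebraicClosure K →+* ℂ}

/-- **The Kummer bridge.** Let `z ∈ 𝔖` be the Λ-adic Heegner class of the family `F` with sign `α` (`α² = 1`), `D ≤ Γ_K`
a subgroup (a decomposition group at the prime `𝔭`), and `loc : 𝔖 →ₗ Λ` a functional with the layer-compatibility
property (L): whenever `loc s ∈ (p)`, the precision-`1` component of `proj_k s` restricted to `Γ_{K_k} ∩ D` vanishes, for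
every `k`. If for some layer `k` every `p`-th root `Q` of the norm point `z_k = F.z k` has NON-ZERO Kummer class over
`Γ_{K_k} ∩ D` (the layer point is locally `p`-indivisible), then `loc z ∉ (p)`.
[cite: BertoliniDarmon1996, §2.5 eq. (7)–(8) (the classes α^{n+1} δ(z_n))] [cite: SilvermanAEC2009, VIII.§2 (Kummer classes restrict to Kummer classes)] -/
theorem loc_not_mem_augIdealP_of_layerIndivisible
    (Dat : (W.baseChange K).LambdaAdicSelmerData κ γ) (F : HeegnerFamily N W K κ jbar)
    {α : ℤ} (hα : α ^ 2 = 1) {z : Dat.S} (hz : IsLambdaAdicHeegnerClass Dat F α z)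
    (Dg : Subgroup (Field.absoluteGaloisGroup K))
    (loc : Dat.S →ₗ[IwasawaAlgebra p] IwasawaAlgebra p)
    (hL : ∀ s : Dat.S, loc s ∈ augIdealP p → ∀ k : ℕ,
      Literature.NumberTheory.EllipticCurves.resOfLe (geomTorsion (W.baseChange K) ((p : ℤ) ^ 1))
        (inf_le_left : κ.layerSubgroup k ⊓ Dg ≤ κ.layerSubgroup k) (Dat.proj k s 1) = 0)
    (hK1 : ∃ k : ℕ, ∀ (Q : geomPoints (W.baseChange K))
      (hQ : ∀ σ ∈ κ.layerSubgroup k ⊓ Dg, σ • (((p : ℤ) ^ 1) • Q) = ((p : ℤ) ^ 1) • Q),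
      ((p : ℤ) ^ 1) • Q = F.z k →
        (W.baseChange K).kummerClassOver (κ.layerSubgroup k ⊓ Dg) ((p : ℤ) ^ 1) Q hQ ≠ 0) :
    loc z ∉ augIdealP p := by
  intro hmem
  obtain ⟨k, hk⟩ := hK1
  have hp1 : ((p : ℤ) ^ 1) ≠ 0 := pow_ne_zero _ (by exact_mod_cast (Fact.out : p.Prime).ne_zero)
  obtain ⟨Q, hQ⟩ := (W.baseChange K).zsmul_geomPoints_surjective_of_charZero hp1 (F.z k)
  dsimp only at hQ
  have hfix : ∀ σ ∈ κ.layerSubgroup k ⊓ Dg, σ • (((p : ℤ) ^ 1) • Q) = ((p : ℤ) ^ 1) • Q := fun σ hσ ↦ by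
    rw [hQ]; exact (F.isHeegnerNormPoint_z k).smul_eq_self (inf_le_left (b := Dg) hσ)
  have h0 := hL z hmem k
  rw [hz.proj_eq k 1 Q hQ, map_zsmul, WeierstrassCurve.resOfLe_kummerClassOver] at h0
  exact hk Q hfix hQ (zsmul_eq_zero_of_sq_eq_one hα k h0)

end Summit.BirchSwinnertonDyer.BirchSwinnertonDyer.Theorems.UniversalToricDescentHeegnerClassKummerBridge

end
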